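import Literature.Computability.AlgebraicComplexity.ChowReciprocityDefs
import Literature.Computability.AlgebraicComplexity.Hyperdeterminant
import Mathlib.RingTheory.MvPolynomial.WeightedHomogeneous
import HarnessLib

/-!
# The comorphism `hadamardHowe` of the product map `(k^N)^n → Ch_n(k^N)`: values, kernel,
# equivariance, form-symmetry, form-degrees, integrality

Topic `Literature/Computability/AlgebraicComplexity`; brick A1 of the val-lit programme "Chow reciprocity"
(architect's objects in `ChowReciprocityDefs.lean`: `ChowReciprocity.hadamardHowe N n =
aeval fun e => coeff e.1 (genericChowProduct N n)`, the comorphism `F ↦ F(∏_l ℓ_l)` of the product map,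
whose degree-`d` part is the Hermite–Hadamard–Howe map `h_{d,n}` (Landsberg, *Geometric Complexity
Theory* (2017), Def. 9.1.1.1); `ChowReciprocity.formSubst N n A`, the substitution `a_l ↦ A a_l` of each
form's coefficient vector; index convention (FORM `l`, VARIABLE `i`) = `Fin n × Fin N`, the variable
`X (l, i)` of `k[Mat_{n×N}]` being the coefficient of `x_i` in the `l`-th form). Theorems only.

* **Values** `eval_hadamardHowe`: `(h F)(a) = F(∏_l ℓ_{a_l})`, the value of `F` at a point of DIP's
  `chowSet k N n` (the tree's `aeval_genericChowMap`, `eval` spelling); `eval_formSubst`: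
  `(formSubst A p)(a) = p(l ↦ A a_l)`.
* **A1.2 Hadamard's kernel theorem** `hadamardHowe_eq_zero_iff` / `ker_hadamardHowe_eq` (infinite field):
  `h F = 0 ↔ F ∈ I(Ch_n(k^N))` (Landsberg Thm. 9.1.1.4 "`ker h_{d,n} = I_d(Ch_n)`"; the tree's
  `vanishingIdeal_chowSet_eq_ker`, named for the architect's map).
* **A1.3 equivariance** `hadamardHowe_coordRep` (infinite field): `h(g · F) = formSubst g⁻¹ (h F)`
  (`(g · F)(q) = F(g⁻¹ · q)` and `g⁻¹ · ∏_l ℓ_{a_l} = ∏_l ℓ_{g⁻¹ a_l}`), whence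
  `formSubst_hadamardHowe_of_mem_highestWeightSpace`: `h` maps a highest-weight vector of weight `χ` of
  `k[Sym^n k^N]` to a `formSubst`-semi-invariant, `formSubst g⁻¹ (h F) = χ(g) • h F` for upper
  triangular `g`.
* **A1.4 form symmetry** `rename_formPerm_hadamardHowe`: `h F` is invariant under permuting the `n` forms.
* **A1.5 form degrees** `isWeightedHomogeneous_hadamardHowe` / `formDegree_hadamardHowe`: for `F`
  homogeneous of degree `d`, every monomial of `h F` has degree `d` in the coefficients of each form
  (`h` maps `k[Sym^n]_d` into `Sym^d V^* ⊗ ⋯ ⊗ Sym^d V^*`, BHI (5): "degree `nk` becomes degree `k`").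
* **the combinatorial model** (for the transpose identity, brick A3): `coeff_genericChowProduct_eq_sum_filter`
  (coefficients of `∏_l ℓ_l` = sums over words of given content), `hadamardHowe_prod_X`
  (`h(∏_r X_{α_r})` = sum over `d × n` arrays with row contents `α_r` of the column-content monomials,
  `prod_prod_X_eq_monomial`, `sum_mapDomain_wordExp_apply`) and `coeff_hadamardHowe_prod_X` (the
  coefficient of `Y^a` COUNTS the arrays with row contents `α` and column contents `a`);
* **A1.6 integrality** `exists_map_eq_hadamardHowe_map`: the image of an integral `G₀` is the reduction of
  an integer polynomial (the generic product has integer coefficients; `hadamardHowe_map` for any ring map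
  `R → k`, and `map_hadamardHowe`: `map φ ∘ h = h ∘ map φ` for a map of fields `φ : k → k'`).

Honest framing: classical invariant theory (Hadamard 1897 / Hermite / Howe) serving DIP 2020's toy
separation; nothing here bears on VP versus VNP.

## References

* J. M. Landsberg, *Geometric Complexity Theory*, CUP 2017, §9.1.1 (Def. 9.1.1.1, Thm. 9.1.1.4),
  Ex. 9.1.2.1. [Landsberg2017]
* P. Bürgisser, J. Hüttenhain, C. Ikenmeyer, Proc. AMS 145 (2017), §3 (`φ_n` equivariant, (5)).
  [BurgisserHuttenhainIkenmeyer2017]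
* J. Dörfler, C. Ikenmeyer, G. Panova, SIAM J. Appl. Algebra Geom. 4 (2020), §2 (`Ch_m^n`), §5 ((5.6)).
  [DorflerIkenmeyerPanova2020]
-/

noncomputable section

open MvPolynomial

namespace Literature.Computability.AlgebraicComplexity

namespace ChowReciprocity

open Literature.NumberTheory.DiophantineGeometry

variable {k : Type} [Field k] (N n : ℕ)

/-! ### Values -/

/-- The comorphism on a coordinate function: `X_e ↦ coeff_e (∏_l ℓ_l)`.
[cite: Landsberg2017, §9.1.1 (Def. 9.1.1.1)] -/
theorem hadamardHowe_X (e : DegIdx (Fin N) n) :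
    hadamardHowe N n (X e) = coeff e.1 (genericChowProduct (k := k) N n) := by
  rw [hadamardHowe, aeval_X]

/-- **Values of the comorphism** (`eval` spelling of the tree's `aeval_genericChowMap`):
`(h F)(a) = F(ℓ_{a_0} ⋯ ℓ_{a_{n-1}})`, the value of `F` at (the coefficient vector of) the product of the
linear forms with coefficient rows `a (l, ·)` — a point of `chowSet k N n` (DIP (5.6)).
[cite: DorflerIkenmeyerPanova2020, §5 ((5.6), arXiv p. 13)] -/
theorem eval_hadamardHowe (a : Fin n × Fin N → k) (F : MvPolynomial (DegIdx (Fin N) n) k) :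
    eval a (hadamardHowe N n F) =
      aeval (formCoeff n (∏ l : Fin n, linearForm (fun i : Fin N => a (l, i)))) F := by
  rw [← aeval_eq_eval]
  exact aeval_genericChowMap N n F (fun l i => a (l, i))

/-- The products of linear forms with coefficient rows `a (l, ·)` are the points of `Ch_n(k^N)`.
[cite: DorflerIkenmeyerPanova2020, §2 (arXiv p. 3: Ch_m^n)] -/
theorem prod_linearForm_mem_chowSet (a : Fin n × Fin N → k) :
    (∏ l : Fin n, linearForm fun i : Fin N => a (l, i)) ∈ chowSet k N n :=
  ⟨fun l i => a (l, i), rfl⟩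

/-! ### A1.2 — Hadamard's kernel theorem -/

/-- **Hadamard's kernel theorem** (`ker h_{d,n} = I_d(Ch_n)`, Landsberg Thm. 9.1.1.4; here for DIP's
`Ch_n(k^N)` with any `N`, `n`, over an infinite field): `h F = 0` iff `F` vanishes on every product of
`n` linear forms in `N` variables — the tree's `vanishingIdeal_chowSet_eq_ker`, named for `hadamardHowe`.
[cite: Landsberg2017, §9.1.1 (Thm. 9.1.1.4: ker h_{d,n} = I_d(Ch_n))] -/
theorem hadamardHowe_eq_zero_iff [Infinite k] (F : MvPolynomial (DegIdx (Fin N) n) k) :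
    hadamardHowe N n F = 0 ↔ F ∈ MvPolynomial.vanishingIdeal k (formCoeff n '' chowSet k N n) := by
  rw [vanishingIdeal_chowSet_eq_ker, RingHom.mem_ker]
  rfl

/-- The kernel of the comorphism is the vanishing ideal of the Chow variety (infinite field).
[cite: Landsberg2017, §9.1.1 (Thm. 9.1.1.4: ker h_{d,n} = I_d(Ch_n))] -/
theorem ker_hadamardHowe_eq [Infinite k] :
    RingHom.ker (hadamardHowe (k := k) N n) =
      MvPolynomial.vanishingIdeal k (formCoeff n '' chowSet k N n) := by
  ext F
  rw [RingHom.mem_ker, hadamardHowe_eq_zero_iff]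

/-- One direction, named: a nonzero image witnesses non-vanishing on `Ch_n(k^N)` (what
`coordRingMultiplicity_pos_iff` consumes). [cite: DorflerIkenmeyerPanova2020, §5 ((5.6), arXiv p. 13)] -/
theorem not_mem_vanishingIdeal_of_hadamardHowe_ne_zero [Infinite k]
    {F : MvPolynomial (DegIdx (Fin N) n) k} (hF : hadamardHowe N n F ≠ 0) :
    F ∉ MvPolynomial.vanishingIdeal k (formCoeff n '' chowSet k N n) :=
  fun h => hF ((hadamardHowe_eq_zero_iff N n F).mpr h)

/-! ### A1.3 — the form substitution and the equivariance of the comorphism -/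

/-- `formSubst A` on a variable (unfolding lemma). [cite: Landsberg2017, §9.1.1 (equivariance of h_{d,n})] -/
theorem formSubst_X (A : Matrix (Fin N) (Fin N) k) (li : Fin n × Fin N) :
    formSubst N n A (X li) = ∑ i' : Fin N, A li.2 i' • X (li.1, i') := by
  rw [formSubst, aeval_X]

/-- **Values of the form substitution**: `(formSubst A p)(a) = p(l ↦ A a_l)`, i.e. evaluation at the
matrix `a'` with `a'_{(l,i)} = ∑_{i'} A_{i i'} a_{(l,i')}`. [cite: Landsberg2017, §9.1.1 (equivariance of h_{d,n})] -/
theorem eval_formSubst (A : Matrix (Fin N) (Fin N) k) (a : Fin n × Fin N → k)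
    (p : MvPolynomial (Fin n × Fin N) k) :
    eval a (formSubst N n A p) =
      eval (fun li : Fin n × Fin N => ∑ i' : Fin N, A li.2 i' * a (li.1, i')) p := by
  rw [formSubst, ← aeval_eq_eval, ← AlgHom.comp_apply, comp_aeval, aeval_eq_eval]
  have hfun : (fun li : Fin n × Fin N => aeval a (∑ i' : Fin N, A li.2 i' • (X (li.1, i') :
      MvPolynomial (Fin n × Fin N) k))) =
      fun li : Fin n × Fin N => ∑ i' : Fin N, A li.2 i' * a (li.1, i') := by
    funext li
    simp [map_sum, smul_eq_mul]
  rw [hfun]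

/-- A linear substitution `x_i ↦ ∑_{i'} A_{i' i} x_{i'}` of a product of linear forms is the product of the
linear forms with coefficient vectors `A a_l`. [folklore] -/
private theorem linSubst_prod_linearForm (A : Matrix (Fin N) (Fin N) k) (a : Fin n × Fin N → k) :
    linSubst (Fin N) k A (∏ l : Fin n, linearForm fun i : Fin N => a (l, i)) =
      ∏ l : Fin n, linearForm fun i : Fin N => ∑ i' : Fin N, A i i' * a (l, i') := by
  rw [map_prod]
  refine Finset.prod_congr rfl fun l _ => ?_
  simp only [linearForm, map_sum, map_mul, linSubst_C, linSubst_X, Finset.mul_sum, smul_eq_C_mul]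
  rw [Finset.sum_comm]
  refine Finset.sum_congr rfl fun i _ => ?_
  rw [Finset.sum_mul]
  exact Finset.sum_congr rfl fun i' _ => by ring

/-- **The comorphism is `GL_N`-equivariant** (`h (g · F) = (h F) ∘ (a_l ↦ g⁻¹ a_l)`; BHI §3: "`φ_n` is
`G`-equivariant"): checked on values at every matrix `a` over an infinite field, using
`aeval_formCoeff_coordSubst` (`(g · F)(q) = F(g⁻¹ · q)`) and `g⁻¹ · ∏_l ℓ_{a_l} = ∏_l ℓ_{g⁻¹ a_l}`.
[cite: Landsberg2017, §9.1.1 (equivariance of h_{d,n})] -/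
theorem hadamardHowe_coordRep [Infinite k] (g : GL (Fin N) k) (F : MvPolynomial (DegIdx (Fin N) n) k) :
    hadamardHowe N n (coordRep (Fin N) k n g F) =
      formSubst N n ((g⁻¹ : GL (Fin N) k) : Matrix (Fin N) (Fin N) k) (hadamardHowe N n F) := by
  apply MvPolynomial.funext
  intro a
  rw [coordRep_apply, eval_hadamardHowe, aeval_formCoeff_coordSubst, eval_formSubst, eval_hadamardHowe,
    linSubstRep_apply, linSubst_prod_linearForm]

/-- Equivariance, `coordSubst` spelling. [cite: Landsberg2017, §9.1.1 (equivariance of h_{d,n})] -/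
theorem hadamardHowe_coordSubst [Infinite k] (g : GL (Fin N) k) (F : MvPolynomial (DegIdx (Fin N) n) k) :
    hadamardHowe N n (coordSubst n g F) =
      formSubst N n ((g⁻¹ : GL (Fin N) k) : Matrix (Fin N) (Fin N) k) (hadamardHowe N n F) :=
  hadamardHowe_coordRep N n g F

/-- Hence **`h` maps highest-weight vectors to `formSubst`-semi-invariants**: if
`F ∈ HWV_χ(k[Sym^n k^N])` then `formSubst g⁻¹ (h F) = χ(g) • h F` for every upper triangular `g`
(infinite field). [cite: Landsberg2017, §9.1.1 (equivariance of h_{d,n})] -/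
theorem formSubst_hadamardHowe_of_mem_highestWeightSpace [Infinite k] {χ : Weight (Fin N)}
    {F : MvPolynomial (DegIdx (Fin N) n) k} (hF : F ∈ highestWeightSpace (coordRep (Fin N) k n) χ)
    {g : GL (Fin N) k} (hg : IsUpperTriangular g) :
    formSubst N n ((g⁻¹ : GL (Fin N) k) : Matrix (Fin N) (Fin N) k) (hadamardHowe N n F) =
      weightChar χ g • hadamardHowe N n F := by
  rw [← hadamardHowe_coordRep, (mem_highestWeightSpace_iff _ _ _).mp hF g hg, map_smul]

/-! ### A1.4 — form symmetry -/

/-- Permuting the forms leaves the generic product unchanged. [folklore] -/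
private theorem map_rename_formPerm_genericChowProduct (π : Equiv.Perm (Fin n)) :
    MvPolynomial.map (rename (fun li : Fin n × Fin N => (π li.1, li.2)) :
        MvPolynomial (Fin n × Fin N) k →ₐ[k] MvPolynomial (Fin n × Fin N) k).toRingHom
      (genericChowProduct (k := k) N n) = genericChowProduct (k := k) N n := by
  rw [genericChowProduct, map_prod]
  have hl : ∀ l : Fin n, MvPolynomial.map (rename (fun li : Fin n × Fin N => (π li.1, li.2)) :
        MvPolynomial (Fin n × Fin N) k →ₐ[k] MvPolynomial (Fin n × Fin N) k).toRingHom
      (∑ j : Fin N, C (X (l, j)) * X j) =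
      ∑ j : Fin N, C (X (π l, j)) * (X j : MvPolynomial (Fin N) (MvPolynomial (Fin n × Fin N) k)) := by
    intro l
    simp only [map_sum, map_mul, map_C, map_X, AlgHom.toRingHom_eq_coe, RingHom.coe_coe, rename_X]
  simp_rw [hl]
  exact Equiv.prod_comp π (fun l => ∑ j : Fin N, C (X (l, j)) *
    (X j : MvPolynomial (Fin N) (MvPolynomial (Fin n × Fin N) k)))

/-- **Form symmetry**: `h F` is invariant under every permutation of the `n` forms.
[cite: Landsberg2017, §9.1.1 (h_{d,n} lands in Sym^n(Sym^d V))] -/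
theorem rename_formPerm_hadamardHowe (π : Equiv.Perm (Fin n)) (F : MvPolynomial (DegIdx (Fin N) n) k) :
    rename (fun li : Fin n × Fin N => (π li.1, li.2)) (hadamardHowe N n F) = hadamardHowe N n F := by
  rw [hadamardHowe, ← AlgHom.comp_apply, comp_aeval]
  have hfun : (fun e : DegIdx (Fin N) n => rename (fun li : Fin n × Fin N => (π li.1, li.2))
      (coeff e.1 (genericChowProduct (k := k) N n))) =
      fun e : DegIdx (Fin N) n => coeff e.1 (genericChowProduct (k := k) N n) := by
    funext e
    have h := congrArg (coeff e.1) (map_rename_formPerm_genericChowProduct (k := k) N n π)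
    rw [coeff_map, AlgHom.toRingHom_eq_coe, RingHom.coe_coe] at h
    exact h
  rw [hfun]

/-! ### A1.5 — form degrees -/

/-- The form-multidegree of a monomial of `k[Mat_{n×N}]` is its weighted degree for the weights
`X (l, i) ↦ e_l ∈ ℕ^n`. [folklore] -/
private theorem weight_single_fst_apply (s : Fin n × Fin N →₀ ℕ) (l : Fin n) :
    Finsupp.weight (fun v : Fin n × Fin N => (Pi.single v.1 1 : Fin n → ℕ)) s l = ∑ i : Fin N, s (l, i) := by
  classical
  rw [Finsupp.weight_apply, Finsupp.sum, Finset.sum_apply]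
  simp only [Pi.smul_apply, Pi.single_apply, smul_eq_mul, mul_ite, mul_one, mul_zero]
  rw [Finset.sum_subset (Finset.subset_univ s.support) (fun v _ hv => by
      rw [Finsupp.notMem_support_iff.mp hv]
      simp)]
  rw [Fintype.sum_prod_type]
  rw [Finset.sum_eq_single l (fun l' _ hl' => Finset.sum_eq_zero fun i _ => if_neg fun h => hl' h.symm)
    (fun h => absurd (Finset.mem_univ l) h)]
  simp

/-- A coefficient of the `l`-th generic linear form is weighted-homogeneous of form degrees `e_l`.
[folklore] -/
private theorem isWeightedHomogeneous_coeff_genericLinForm (l : Fin n) (α : Fin N →₀ ℕ) :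
    IsWeightedHomogeneous (fun v : Fin n × Fin N => (Pi.single v.1 1 : Fin n → ℕ))
      (coeff α (∑ j : Fin N, C (X (l, j)) * (X j : MvPolynomial (Fin N) (MvPolynomial (Fin n × Fin N) k))))
      (Pi.single l 1) := by
  classical
  simp only [coeff_sum, coeff_C_mul, coeff_X, mul_ite, mul_one, mul_zero]
  refine IsWeightedHomogeneous.sum _ _ _ fun j _ => ?_
  split_ifs
  · exact isWeightedHomogeneous_X _ _ _
  · exact isWeightedHomogeneous_zero _ _ _

/-- The coefficients of `∏_{l ∈ S} ℓ_l` have form degrees `1` on `S` and `0` off `S`. [folklore] -/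
private theorem isWeightedHomogeneous_coeff_prod_genericLinForm (S : Finset (Fin n)) (γ : Fin N →₀ ℕ) :
    IsWeightedHomogeneous (fun v : Fin n × Fin N => (Pi.single v.1 1 : Fin n → ℕ))
      (coeff γ (∏ l ∈ S, ∑ j : Fin N, C (X (l, j)) *
        (X j : MvPolynomial (Fin N) (MvPolynomial (Fin n × Fin N) k)))) (∑ l ∈ S, Pi.single l 1) := by
  classical
  induction S using Finset.induction_on generalizing γ with
  | empty =>
    rw [Finset.prod_empty, Finset.sum_empty, coeff_one]
    split_ifs
    · exact isWeightedHomogeneous_one _ _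
    · exact isWeightedHomogeneous_zero _ _ _
  | insert l₀ S hl₀ ih =>
    rw [Finset.prod_insert hl₀, Finset.sum_insert hl₀, coeff_mul]
    refine IsWeightedHomogeneous.sum _ _ _ fun p _ => ?_
    exact (isWeightedHomogeneous_coeff_genericLinForm N n l₀ p.1).mul (ih p.2)

/-- Substituting weighted-homogeneous elements of one weighted degree `m₀` for the variables of a
homogeneous polynomial of degree `d` gives a weighted-homogeneous polynomial of weighted degree `d • m₀`.
[folklore] -/
private theorem isWeightedHomogeneous_aeval_of_isHomogeneous {σ τ M : Type*} [AddCommMonoid M]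
    {F : MvPolynomial σ k} {d : ℕ} (hF : F.IsHomogeneous d) {w : τ → M} {m₀ : M}
    (v : σ → MvPolynomial τ k) (hv : ∀ e, IsWeightedHomogeneous w (v e) m₀) :
    IsWeightedHomogeneous w (aeval v F) (d • m₀) := by
  classical
  rw [F.as_sum, map_sum]
  refine IsWeightedHomogeneous.sum _ _ _ fun s hs => ?_
  rw [aeval_monomial, MvPolynomial.algebraMap_eq, Finsupp.prod]
  refine IsWeightedHomogeneous.C_mul ?_ _
  have hdeg : ∑ e ∈ s.support, s e = d := by
    have h := hF (mem_support_iff.mp hs)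
    rw [Finsupp.weight_apply, Finsupp.sum] at h
    simpa using h
  have hprod := IsWeightedHomogeneous.prod s.support (fun e => v e ^ s e) (fun e => s e • m₀)
    (w := w) fun e _ => (hv e).pow _
  rwa [← Finset.sum_smul, hdeg] at hprod

/-- **The image of the comorphism on forms of degree `d` has form multidegree `(d, …, d)`**
(weighted-homogeneity for the weights `X (l, i) ↦ e_l`): `h` maps `k[Sym^n k^N]_d` into
`Sym^d V^* ⊗ ⋯ ⊗ Sym^d V^*` (BHI (5): "degree `nk` becomes degree `k`").
[cite: Landsberg2017, §9.1.1 (Def. 9.1.1.1: h_{d,n} : S^d(S^n V) → S^n(S^d V))] -/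
theorem isWeightedHomogeneous_hadamardHowe {d : ℕ} {F : MvPolynomial (DegIdx (Fin N) n) k}
    (hF : F.IsHomogeneous d) :
    IsWeightedHomogeneous (fun v : Fin n × Fin N => (Pi.single v.1 1 : Fin n → ℕ)) (hadamardHowe N n F)
      (fun _ : Fin n => d) := by
  have h := isWeightedHomogeneous_aeval_of_isHomogeneous hF
    (fun e : DegIdx (Fin N) n => coeff e.1 (genericChowProduct (k := k) N n))
    (m₀ := fun _ : Fin n => 1) fun e => by
      have h1 := isWeightedHomogeneous_coeff_prod_genericLinForm (k := k) N n Finset.univ e.1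
      rwa [Finset.univ_sum_single] at h1
  rwa [show (d • fun _ : Fin n => (1 : ℕ)) = fun _ : Fin n => d by funext j; simp] at h

/-- **Form degrees**: for `F` homogeneous of degree `d`, every monomial of `h F` has degree `d` in the
coefficients of each of the `n` forms. [cite: Landsberg2017, §9.1.1 (Def. 9.1.1.1: h_{d,n} : S^d(S^n V) → S^n(S^d V))] -/
theorem formDegree_hadamardHowe {d : ℕ} {F : MvPolynomial (DegIdx (Fin N) n) k} (hF : F.IsHomogeneous d)
    {a : Fin n × Fin N →₀ ℕ} (ha : a ∈ (hadamardHowe N n F).support) (l : Fin n) :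
    ∑ i : Fin N, a (l, i) = d := by
  have h := isWeightedHomogeneous_hadamardHowe N n hF (mem_support_iff.mp ha)
  rw [← weight_single_fst_apply, h]

/-! ### A1.6 — integrality -/

/-- **Base change of the comorphism** along a ring map into `k`: for `G` with coefficients in a commutative
ring `R` and `φ : R → k`, `h (map φ G)` is `map φ` of the SAME construction over `R` (the generic product
`∏_l ∑_i Y_{(l,i)} x_i` has coefficients in the prime ring).
[cite: Landsberg2017, §9.1.1 (Def. 9.1.1.1)] -/
theorem hadamardHowe_map {R : Type*} [CommRing R] (φ : R →+* k) (G : MvPolynomial (DegIdx (Fin N) n) R) :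
    hadamardHowe N n (MvPolynomial.map φ G) = MvPolynomial.map φ
      (aeval (R := R) (fun e : DegIdx (Fin N) n => coeff e.1
        (∏ l : Fin n, ∑ i : Fin N, C (X (l, i)) * (X i : MvPolynomial (Fin N) (MvPolynomial (Fin n × Fin N) R))))
        G) := by
  have hgen : MvPolynomial.map (MvPolynomial.map φ)
      (∏ l : Fin n, ∑ i : Fin N, C (X (l, i)) * (X i : MvPolynomial (Fin N) (MvPolynomial (Fin n × Fin N) R))) =
      genericChowProduct (k := k) N n := by
    simp only [genericChowProduct, map_prod, map_sum, map_mul, map_C, map_X]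
  have key : (hadamardHowe (k := k) N n : MvPolynomial (DegIdx (Fin N) n) k →+*
      MvPolynomial (Fin n × Fin N) k).comp (MvPolynomial.map φ) =
      (MvPolynomial.map φ).comp (aeval (R := R) (fun e : DegIdx (Fin N) n => coeff e.1
        (∏ l : Fin n, ∑ i : Fin N, C (X (l, i)) *
          (X i : MvPolynomial (Fin N) (MvPolynomial (Fin n × Fin N) R))))).toRingHom := by
    refine MvPolynomial.ringHom_ext (fun r => ?_) (fun e => ?_)
    · simp only [RingHom.comp_apply, RingHom.coe_coe, AlgHom.toRingHom_eq_coe, map_C,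
        MvPolynomial.algHom_C, MvPolynomial.algebraMap_eq]
    · simp only [RingHom.comp_apply, RingHom.coe_coe, AlgHom.toRingHom_eq_coe, map_X, hadamardHowe_X,
        aeval_X]
      rw [← hgen, coeff_map]
  have h := RingHom.congr_fun key G
  simpa only [RingHom.comp_apply, RingHom.coe_coe, AlgHom.toRingHom_eq_coe] using h

/-- **Change of base field** (e.g. coefficientwise complex conjugation, `φ = starRingEnd ℂ`): the
comorphism commutes with `map φ` for every ring map `φ : k → k'` of fields.
[cite: Landsberg2017, §9.1.1 (Def. 9.1.1.1)] -/
theorem map_hadamardHowe {k' : Type} [Field k'] (φ : k →+* k') (F : MvPolynomial (DegIdx (Fin N) n) k) :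
    MvPolynomial.map φ (hadamardHowe N n F) = hadamardHowe N n (MvPolynomial.map φ F) :=
  (hadamardHowe_map N n φ F).symm

/-- **Integrality** (A1.6 of the programme): the image of an integral `G₀` is the reduction of an integer
polynomial. [cite: Landsberg2017, §9.1.1 (Def. 9.1.1.1)] -/
theorem exists_map_eq_hadamardHowe_map (G₀ : MvPolynomial (DegIdx (Fin N) n) ℤ) :
    ∃ p₀ : MvPolynomial (Fin n × Fin N) ℤ,
      MvPolynomial.map (Int.castRingHom k) p₀ =
        hadamardHowe N n (MvPolynomial.map (Int.castRingHom k) G₀) :=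
  ⟨_, (hadamardHowe_map N n (Int.castRingHom k) G₀).symm⟩

/-! ### Word and array expansions (the combinatorial model of `h` on monomials) -/

/-- The monomial of a word is the product of its letters (the tree's `prod_X_eq_monomial_wordExp`, over
any commutative coefficient ring). [folklore] -/
private theorem prod_X_eq_monomial_wordExp_comm {R σ : Type*} [CommSemiring R] {ℓ : ℕ} (J : Fin ℓ → σ) :
    (∏ j, X (J j) : MvPolynomial σ R) = monomial (wordExp J) 1 := by
  rw [wordExp, monomial_sum_index, C_1, one_mul]
  rfl

/-- **The coefficients of the generic product are word sums**: the coefficient of `x^e` in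
`∏_l (∑_i Y_{(l,i)} x_i)` is `∑_{w : Fin n → Fin N, content w = e} ∏_l Y_{(l, w l)}` (expand the
product over choice functions; the content of a word is the tree's `wordExp`).
[cite: Landsberg2017, §9.1.1 (Def. 9.1.1.1: F(ℓ_1⋯ℓ_n) written out)] -/
theorem coeff_genericChowProduct_eq_sum_filter (e : Fin N →₀ ℕ) :
    coeff e (genericChowProduct (k := k) N n) =
      ∑ w ∈ Finset.univ.filter (fun w : Fin n → Fin N => wordExp w = e),
        ∏ l : Fin n, (X (l, w l) : MvPolynomial (Fin n × Fin N) k) := by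
  classical
  have hexp : genericChowProduct (k := k) N n =
      ∑ w : Fin n → Fin N, monomial (wordExp w) (∏ l : Fin n, (X (l, w l) : MvPolynomial (Fin n × Fin N) k)) := by
    rw [genericChowProduct, Finset.prod_univ_sum, Fintype.piFinset_univ]
    refine Finset.sum_congr rfl fun w _ => ?_
    rw [Finset.prod_mul_distrib, ← map_prod, prod_X_eq_monomial_wordExp_comm w, C_mul_monomial, mul_one]
  rw [hexp, coeff_sum, Finset.sum_filter]
  refine Finset.sum_congr rfl fun w _ => ?_
  rw [coeff_monomial]

/-- **`h` on a monomial, as a sum over arrays**: for coordinate functions `X_{α_0}, …, X_{α_{d-1}}`,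
`h(∏_r X_{α_r}) = ∑_M ∏_{r,l} Y_{(l, M r l)}`, the sum over the `d × n` arrays `M` of variable
indices whose `r`-th row has content `α_r` (each row of `M` is a word spelling `x^{α_r}` out of the
`n` forms). [cite: Landsberg2017, §9.1.1 (Def. 9.1.1.1), Ex. 9.1.2.1 (arrays)] -/
theorem hadamardHowe_prod_X {d : ℕ} (α : Fin d → DegIdx (Fin N) n) :
    hadamardHowe N n (∏ r : Fin d, X (α r)) =
      ∑ M ∈ Fintype.piFinset (fun r : Fin d =>
          Finset.univ.filter (fun w : Fin n → Fin N => wordExp w = (α r).1)),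
        ∏ r : Fin d, ∏ l : Fin n, (X (l, M r l) : MvPolynomial (Fin n × Fin N) k) := by
  classical
  rw [map_prod]
  simp_rw [hadamardHowe_X, coeff_genericChowProduct_eq_sum_filter]
  rw [Finset.prod_univ_sum]

/-- The exponent of the array monomial `∏_{r,l} Y_{(l, M r l)}`: the variable `Y_{(l,i)}` occurs as many
times as `i` occurs in the `l`-th COLUMN of `M` — the content of the column word `r ↦ M r l`.
[cite: Landsberg2017, Ex. 9.1.2.1 (arrays)] -/
theorem prod_prod_X_eq_monomial {d : ℕ} (M : Fin d → Fin n → Fin N) :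
    (∏ r : Fin d, ∏ l : Fin n, (X (l, M r l) : MvPolynomial (Fin n × Fin N) k)) =
      monomial (∑ l : Fin n, (wordExp fun r : Fin d => M r l).mapDomain fun i : Fin N => (l, i)) 1 := by
  rw [Finset.prod_comm, monomial_sum_index, C_1, one_mul]
  refine Finset.prod_congr rfl fun l _ => ?_
  rw [wordExp, Finsupp.mapDomain_finsetSum, monomial_sum_index, C_1, one_mul]
  refine Finset.prod_congr rfl fun r _ => ?_
  rw [Finsupp.mapDomain_single, X]

/-- The column-content exponent, evaluated: the exponent of `Y_{(l,i)}` is the number of rows `r`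
with `M r l = i`. [cite: Landsberg2017, Ex. 9.1.2.1 (arrays)] -/
theorem sum_mapDomain_wordExp_apply {d : ℕ} (M : Fin d → Fin n → Fin N) (l : Fin n) (i : Fin N) :
    (∑ l' : Fin n, (wordExp fun r : Fin d => M r l').mapDomain fun i' : Fin N => (l', i')) (l, i) =
      wordExp (fun r : Fin d => M r l) i := by
  classical
  rw [Finsupp.coe_finsetSum, Finset.sum_apply,
    Finset.sum_eq_single l (fun l' _ hl' => ?_) (fun h => absurd (Finset.mem_univ l) h)]
  · exact Finsupp.mapDomain_apply (fun i₁ i₂ h => (Prod.mk.inj h).2) _ i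
  · exact Finsupp.mapDomain_notin_range _ _ (by rintro ⟨i', hi'⟩; exact hl' (Prod.mk.inj hi').1)

/-- The column-content exponent equals `a` iff every column word of `M` has the content prescribed by
`a` (the array-counting condition spelled column by column). [cite: Landsberg2017, Ex. 9.1.2.1 (arrays)] -/
theorem sum_mapDomain_wordExp_eq_iff {d : ℕ} (M : Fin d → Fin n → Fin N) (a : Fin n × Fin N →₀ ℕ) :
    (∑ l : Fin n, (wordExp fun r : Fin d => M r l).mapDomain fun i : Fin N => (l, i)) = a ↔
      ∀ (l : Fin n) (i : Fin N), wordExp (fun r : Fin d => M r l) i = a (l, i) := by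
  constructor
  · intro h l i
    rw [← h, sum_mapDomain_wordExp_apply]
  · intro h
    ext ⟨l, i⟩
    rw [sum_mapDomain_wordExp_apply, h]

/-- **Coefficients of `h` on a monomial count arrays**: the coefficient of `Y^a` in
`h(∏_r X_{α_r})` is the number of `d × n` arrays of variable indices with row contents `α_r` and
column contents prescribed by `a` (column `l` has content `i ↦ a (l, i)`).
[cite: Landsberg2017, Ex. 9.1.2.1 (both sides count arrays)] -/
theorem coeff_hadamardHowe_prod_X {d : ℕ} (α : Fin d → DegIdx (Fin N) n) (a : Fin n × Fin N →₀ ℕ) :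
    coeff a (hadamardHowe N n (∏ r : Fin d, X (α r))) =
      (((Fintype.piFinset (fun r : Fin d =>
          Finset.univ.filter (fun w : Fin n → Fin N => wordExp w = (α r).1))).filter
        (fun M => (∑ l : Fin n, (wordExp fun r : Fin d => M r l).mapDomain fun i : Fin N => (l, i)) = a)).card :
        k) := by
  classical
  rw [hadamardHowe_prod_X, coeff_sum, Finset.natCast_card_filter]
  refine Finset.sum_congr rfl fun M _ => ?_
  rw [prod_prod_X_eq_monomial, coeff_monomial]

end ChowReciprocity

end Literature.Computability.AlgebraicComplexity

end
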